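import Literature.IUT.HodgeArakelov.MonoThetaProjectivePointedInversionPrime
import Literature.IUT.HodgeArakelov.ThetaSettingPointedInversionEmptyAtModelTate
import Literature.IUT.HodgeArakelov.ThetaEvaluationCor112AtModelTateSectionTranslates
import HarnessLib

/-!
# [IUTchII] Rmk 1.4.1 (ii) at the stage-2 Tate model, PRIMED: the data type `PointedInversion'` IS INHABITED there, while
# its separated uniqueness clause (U1) `IsUniqueOuter` FAILS for EVERY candidate (proof-only; G11 negative/positive pair at the model)

abc-iut cell, layer L6, seat abc-iut-L6-t1 (gen 8) — option (e), file 2, of the design memo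
HOME/staging/L6/L6-t1/g8/PINV-PRIME-DESIGN-MEMO.md (row R5-3 «PINV-PRIME DESIGN MEMO», abc-iut-L6-lead g8 §F v1.19du (A3)).
S. Mochizuki, *Inter-universal Teichmüller theory II*, kurims manuscript (Dec. 2020), Rmk. 1.4.1 (ii) pp. 28–29
[cite: Mochizuki2012, Rmk 1.4.1 (ii) p.28]; claim key `Mochizuki2012` (D-0012, DISPUTED). PROOF-ONLY: no definition, no
instance, no `Prop`-valued definition; every input consumed BY NAME; nothing landed is edited or restated.

WHAT. abc-iut-L6-d2 (`ModelTateCarriers.not_huniq_modelTate`, p495619) and abc-iut-L6-d6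
(`ModelTateCarriers.isEmpty_pointedInversion_modelTate`, p496512) show that at the stage-2 Tate model the FROZEN type
`PointedInversion Env₀ D` is EMPTY for every `hP`, `D` — because its bundled field `iota_unique` (print's (U1) «the unique order
two `Δ^tp`-outer automorphism over `G_k`») fails there (model artefact: the model's `Π^tp` is not normally terminal in its
completion, abc-iut-L6-d2 p496104). Over the PRIMED type of `MonoThetaProjectivePointedInversionPrime.lean` this file records
the two complementary KERNEL facts:

* `forall_not_isUniqueOuter_modelTate` — for every `hP`, every `D` and EVERY primed datum `J : PointedInversion' Env₀ D`,
  `¬ J.IsUniqueOuter` (two admissible involutions that are not `Δ`-conjugate — `α := ι|Π^tp_{X̲̲}` and abc-iut-L6-d2's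
  `κ_u` — defeat uniqueness for every candidate `J.iota`; abc-iut-L6-d6's `exists_kerConj_trans`);
* `rmk141'_modelTate` — for every `hP` and every (H1) witness `hcharY`, the primed existence clause
  `Rmk141_pointedInversion' Env₀ D_rec` HOLDS at the [EtTh]-side datum of record
  `D_rec := etaleThetaDataOfSetting' C hC hS hcharY (EtaleLevels.setting …) (refl) rfl` (the `D` of the Cor. 1.12 telescope
  p472143 → p477403): the explicit inhabitant has `iota := α` (over `G` WITHOUT F-0620, by abc-iut-L6-d2's
  `projG_isoX_envOfGroup_eq_one_iff_aug_modelTate`; `α ∘ α = id`; not `Δ`-inner by `not_inner_of_toLZ`),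
  `iotaYdd := iotaYddOfAut C hcharY α`, `Dmu := Π^tp_{X̲̲} ∩ inr(G_{ℚ_p})` (the `ι`-fixed Galois section of record,
  `inrRange_subgroupOf_le_piYdd`, `exists_fixD_inrRange_subgroupOf`), `etaStd :=` the ROOT member of the orbit with
  `standard := hstd_rootMember_of_section` — every field a theorem ALREADY used as a `let` by p477403;
* `rmk141'_and_not_rmk141_modelTate` — the G11 pair «primed existence ∧ ¬ frozen existence» at `D_rec`.

Residual binders: `hP` (inhabited by `⟨refl⟩`) and (H1) `hcharY` (F-2633 at the instance) — NO `huniq`, NO F-0620.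
HONEST FRAMING: statements about OUR semi-synthetic Tate model and OUR typed interface; an inhabited primed type at the model
is binder-satisfiability evidence for the typed interface minus (U1), not a claim about print; no side taken on [IUTchIII]
Cor. 3.12; typed ≠ proved; nothing here asserts abc proved or refuted. [claim: Mochizuki2012, status: disputed]
FILING / PROVENANCE (abc-iut-L6-lead g8 §F v1.19eb (C)): K-L6 row «(e2) PINV-PRIME-AT-MODELTATE», holder abc-iut-L6-d6 (gen 9);
AUTHOR OF BYTES abc-iut-L6-t1 (gen 8) — this is its `PointedInversionPrimeAtModelTate.READY.lean` (sha16 e473e3fc3f205265, staged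
HOME/staging/L6/L6-t1/g8/) VERBATIM except: (i) in each of the three statements ONE leading `let` is moved to the head of the
telescope (`hO` / `K₀` / `hYcl` first) and the matching `intro` reordered — the gate's statement-dedup keys on the PRINTED HEAD of a
`let`-telescope (dry-run of the verbatim bytes: `dedup.landed` ≡ p477403 `cor112_model_modelTate` / p496512
`isEmpty_pointedInversion_modelTate`, whose telescopes open with the same lines although the conclusions differ); the mathematical
content is order-independent; (ii) §3 `isEmpty_subtype_isUniqueOuter_modelTate` appended by abc-iut-L6-d6 (the frozen type's image
`{I' // I'.IsUniqueOuter}` under abc-iut-L6-t1's `equivSubtype` is EMPTY at the model, every `hP`, `D`).  abc-iut-L6-d6's independent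
twin of §1–§2 (`ThetaSettingPointedInversionPrimeAtModelTate.lean`, farm-clean, staged HOME/staging/L6/L6-d6/g9/, UNFILED) is
concurring evidence only — one file, one holder, one author-of-bytes credit, as ruled.
-/

noncomputable section

namespace Literature.IUT.HodgeArakelov

open Literature.AnabelianGeometry.AbsoluteAnabelian
open Literature.AnabelianGeometry.EtaleTheta Literature.AnabelianGeometry.SemiGraphs CohomologySystemOfContH1
open Literature.AnabelianGeometry.EtaleTheta.SettingModel
open Literature.NumberTheory.GaloisRepresentations
open scoped Literature.AnabelianGeometry.EtaleTheta
open EtaleThetaDataOfSetting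

namespace ModelTateCarriers

variable (p : ℕ) [Fact p.Prime] (l : ℕ+) (hl : Odd (l : ℕ)) (hlp : (l : ℕ).Prime) (hdvd : 4 * (l : ℕ) ∣ p - 1)
  {Es : Set ℕ+} (τ : (ThetaSetting.modelχq p 1 2 even_two).CyclotomeTower l Es)

/-- **(U1) FAILS for EVERY primed candidate at the stage-2 Tate model**: for every identification `hP`, every [EtTh]-side datum
`D` and every `J : PointedInversion' Env₀ D`, `¬ J.IsUniqueOuter` — same `let`-prefix as abc-iut-L6-d6's
`isEmpty_pointedInversion_modelTate` (p496512). If `J.IsUniqueOuter` held, the admissible involution `α := ι|Π^tp_{X̲̲}` and every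
admissible `κ` would both be `Δ`-conjugate to `J.iota`, hence `κ` to `α` (`exists_kerConj_trans`) — i.e. `huniq(α)`, refuted by
abc-iut-L6-d2's `not_huniq_modelTate` (p495619). [claim: Mochizuki2012, status: disputed] (IUTchII §1 Rmk 1.4.1 (ii), kurims p.28) -/
theorem forall_not_isUniqueOuter_modelTate :
    let hO := ThetaSetting.modelχq_isEtThOrigin p 1 2 even_two
    let hS := ThetaSetting.modelχq_sec2Hyps p 1 2 even_two
    let hC := compat_modelχq p 1 2 even_two
    let K₀ := (kummerCoreχq p 1 2 even_two).toKummerDataOfSection SemidirectProduct.inr (continuous_inrχq p 1 2)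
        (fun _ => rfl) (map_inr_GK_le_GtpY_modelχq' p 1 2 even_two) (map_inr_GKdd_le_GtpYdd_modelχq' p 1 2 even_two)
    let C := (K₀.etaleThetaDataOfClass (etaDdχq p 1 2 even_two)).doubleUnderlineχqOfEtaRes p 1 2 l hl
        (eta_res_etaDdχq p 1 2 even_two l hl)
    let f := EtaleThetaDataOfSetting.rootLift C
    let hf : f ∈ C.rootCocycles hC := rootLift_mem_rootCocycles C hC
    let h15 : Literature.AnabelianGeometry.EtaleTheta.ThetaSetting.Prop15iii _ hC :=
      prop15iii_etaleThetaDataOfClass_etaDdχq p hC SemidirectProduct.inr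
        (continuous_inrχq p 1 2) (fun _ => rfl) (map_inr_GK_le_GtpY_modelχq' p 1 2 even_two)
        (map_inr_GKdd_le_GtpYdd_modelχq' p 1 2 even_two)
    let L : C.CuspLabels := ⟨fun _ => ∅, fun _ => ∅, fun _ => rfl⟩
    let hYcl := hYcl_modelχq p 1 2 even_two
    let hp2 := ne_two_of_four_mul_dvd_pred p l.pos hdvd
    let hpl := ne_of_four_mul_dvd_pred p l.pos hdvd
    let hζ := exists_isPrimitiveRoot_K_modelχq p 1 2 even_two l.pos hdvd
    let hZ : ∀ M : ℕ+, Nonempty (ModelCyclotomes.lDeltaQuot (C.rigidData (τ.modAll M) hC hS h15 L) ≃*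
        Literature.IUT.HodgeTheaters.ZHat) := fun M =>
      ModelCyclotomes.nonempty_lDeltaQuot_rigidData_mulEquiv_zHat C (τ.modAll M) hC hS h15 L hO hYcl hlp.ne_zero
    ∀ (hP : Nonempty ((EtaleThetaDataOfSetting.Pi C) ≃ₜ* (EtaleLevels.setting C hC hS hlp hp2 hpl hζ τ.modAll f hf).PiX)),
    let Env₀ : EnvOfGroup (EtaleLevels.setting C hC hS hlp hp2 hpl hζ τ.modAll f hf)
        (EtaleLevels.modelSystem C hC hS hlp hp2 hpl hζ τ.modAll f hf τ.red_modAll h15 L hZ).PiX :=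
      ThetaSetting.envOfGroup (C.rigidData (τ.modAll 1) hC hS h15 L)
        (ThetaSetting.SideData.ofDoubleUnderline C (τ.modAll 1) hC hS hlp hp2 hpl hζ (EtaleLevels.eta0_mem C hC hS τ.modAll f hf 1))
        (ThetaSetting.t1Space_Huu C) (ThetaSetting.isClosed_ker_aug_thetaEnvData C (τ.modAll 1) hC hS) (hZ 1)
        (EtaleThetaDataOfSetting.Pi C) hP
    ∀ (D : EtaleThetaData (EtaleLevels.setting C hC hS hlp hp2 hpl hζ τ.modAll f hf)
        (EtaleLevels.modelSystem C hC hS hlp hp2 hpl hζ τ.modAll f hf τ.red_modAll h15 L hZ).PiX)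
      (J : PointedInversion' Env₀ D), ¬ J.IsUniqueOuter := by
  intro hO hS hC K₀ C f hf h15 L hYcl hp2 hpl hζ hZ hP Env₀ D J hJ
  -- the admissible involution `α := ι|Π^tp_{X̲̲}` (verbatim as in abc-iut-L6-d6's p496512)
  let ι := inversionχq p 1 2
  have hιA : (ThetaSetting.modelχq p 1 2 even_two).IsInversionAut ι := isInversionAut_inversionχq p 1 2 even_two
  have hι : C.Huu.map ι.toMulEquiv.toMonoidHom = C.Huu := map_Huuχq_inversionχq p 1 2 l hl
  let α : (EtaleThetaDataOfSetting.Pi C) ≃ₜ* (EtaleThetaDataOfSetting.Pi C) := EtaleThetaDataOfSetting.inversionAlpha C ι hι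
  have hover : ∀ x, Env₀.recon.projG (Env₀.isoX (α x)) = Env₀.recon.projG (Env₀.isoX x) := by
    intro x
    rw [← inv_mul_eq_one, ← map_inv, ← map_mul, ← map_inv, ← map_mul]
    refine (EtaleThetaDataOfSetting.projG_isoX_envOfGroup_eq_one_iff_aug_modelTate p 1 2 even_two C (τ.modAll 1) hC hS
      h15 L hlp hp2 hpl hζ (EtaleLevels.eta0_mem C hC hS τ.modAll f hf 1) (hZ 1) hP ((α x)⁻¹ * x)).2 ?_
    show augχq p 1 2 ((ι (x : PiTpχq p 1 2))⁻¹ * (x : PiTpχq p 1 2)) = 1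
    rw [map_mul, map_inv]
    change (ι (x : PiTpχq p 1 2)).right⁻¹ * (x : PiTpχq p 1 2).right = 1
    rw [show (ι (x : PiTpχq p 1 2)).right = (x : PiTpχq p 1 2).right from rfl, inv_mul_cancel]
  have hδ : Env₀.recon.projG (Env₀.isoX 1) = 1 :=
    EtaleThetaDataOfSetting.projG_isoX_envOfGroup_one C (τ.modAll 1) hC hS h15 L hlp hp2 hpl hζ
      (EtaleLevels.eta0_mem C hC hS τ.modAll f hf 1) (hZ 1) hP
  have hαα : ∀ x : EtaleThetaDataOfSetting.Pi C, α (α x) = 1 * x * 1⁻¹ :=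
    EtaleThetaDataOfSetting.inversionAlpha_inversionAlpha_of_sq C ι hι 1
      (EtaleThetaDataOfSetting.sq_conj_one_of_involutive C ι (inversionχq_inversionχq p 1 2))
  let γ : EtaleThetaDataOfSetting.Pi C := (C.toLZ_surjective (Multiplicative.ofAdd 1)).choose
  have hγ : C.toLZ γ = Multiplicative.ofAdd 1 := (C.toLZ_surjective (Multiplicative.ofAdd 1)).choose_spec
  have hαγ : C.toLZ (α γ) = Multiplicative.ofAdd (-1) :=
    EtaleThetaDataOfSetting.toLZ_inversionAlpha_generator C ι hι γ hγ (hιA.toZ_apply γ)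
  have hnot := EtaleThetaDataOfSetting.not_inner_of_toLZ C α γ hγ hαγ (fun x => Env₀.recon.projG (Env₀.isoX x) = 1)
  -- `J.IsUniqueOuter` would give `huniq(α)`: every admissible `κ` and `α` itself are `Δ`-conjugate to `J.iota`
  refine not_huniq_modelTate p l hl hlp hdvd τ hP fun κ hκo hκs hκn => ?_
  exact exists_kerConj_trans (Env₀.recon.projG.comp Env₀.isoX.toMulEquiv.toMonoidHom) J.iota α κ
    (hJ α hover ⟨1, hδ, hαα⟩ hnot) (hJ κ hκo hκs hκn)

/-- **The PRIMED existence clause of [IUTchII] Rmk. 1.4.1 (ii) HOLDS at the stage-2 Tate model**: for every identification `hP` and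
every (H1) witness `hcharY`, `Rmk141_pointedInversion' Env₀ D_rec` at the [EtTh]-side datum of the Cor. 1.12 telescope
`D_rec := etaleThetaDataOfSetting' C hC hS hcharY (EtaleLevels.setting …) (refl) rfl` — an EXPLICIT inhabitant whose fourteen
fields are the `let`s of abc-iut's p477403 `cor112_model_modelTate_section_translates`: `iota := α` over `G` (F-0620-free, via
abc-iut-L6-d2's `projG_isoX_envOfGroup_eq_one_iff_aug_modelTate`), `α ∘ α = id` (`δ := 1`), not `Δ`-inner (`not_inner_of_toLZ`),
`iotaYdd := iotaYddOfAut C hcharY α`, `Dmu := Π^tp_{X̲̲} ∩ inr(G_{ℚ_p})` (`inrRange_subgroupOf_le_piYdd`,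
`exists_fixD_inrRange_subgroupOf` with `δ' := 1`), `etaStd :=` the root member (`σ₀ = 1`), `standard := hstd_rootMember_of_section`.
Residual: `hP`, `hcharY` only. [claim: Mochizuki2012, status: disputed] (IUTchII §1 Rmk 1.4.1 (ii), kurims pp.28-29) -/
theorem rmk141'_modelTate :
    let K₀ := (kummerCoreχq p 1 2 even_two).toKummerDataOfSection SemidirectProduct.inr (continuous_inrχq p 1 2)
        (fun _ => rfl) (map_inr_GK_le_GtpY_modelχq' p 1 2 even_two) (map_inr_GKdd_le_GtpYdd_modelχq' p 1 2 even_two)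
    let hC := compat_modelχq p 1 2 even_two
    let hS := ThetaSetting.modelχq_sec2Hyps p 1 2 even_two
    let C := (K₀.etaleThetaDataOfClass (etaDdχq p 1 2 even_two)).doubleUnderlineχqOfEtaRes p 1 2 l hl
        (eta_res_etaDdχq p 1 2 even_two l hl)
    let f := EtaleThetaDataOfSetting.rootLift C
    let hf : f ∈ C.rootCocycles hC := rootLift_mem_rootCocycles C hC
    let h15 : Literature.AnabelianGeometry.EtaleTheta.ThetaSetting.Prop15iii _ hC :=
      prop15iii_etaleThetaDataOfClass_etaDdχq p hC SemidirectProduct.inr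
        (continuous_inrχq p 1 2) (fun _ => rfl) (map_inr_GK_le_GtpY_modelχq' p 1 2 even_two)
        (map_inr_GKdd_le_GtpYdd_modelχq' p 1 2 even_two)
    let L : C.CuspLabels := ⟨fun _ => ∅, fun _ => ∅, fun _ => rfl⟩
    let hO := ThetaSetting.modelχq_isEtThOrigin p 1 2 even_two
    let hYcl := hYcl_modelχq p 1 2 even_two
    let hp2 := ne_two_of_four_mul_dvd_pred p l.pos hdvd
    let hpl := ne_of_four_mul_dvd_pred p l.pos hdvd
    let hζ := exists_isPrimitiveRoot_K_modelχq p 1 2 even_two l.pos hdvd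
    let hZ : ∀ M : ℕ+, Nonempty (ModelCyclotomes.lDeltaQuot (C.rigidData (τ.modAll M) hC hS h15 L) ≃*
        Literature.IUT.HodgeTheaters.ZHat) := fun M =>
      ModelCyclotomes.nonempty_lDeltaQuot_rigidData_mulEquiv_zHat C (τ.modAll M) hC hS h15 L hO hYcl hlp.ne_zero
    ∀ (hP : Nonempty ((EtaleThetaDataOfSetting.Pi C) ≃ₜ* (EtaleLevels.setting C hC hS hlp hp2 hpl hζ τ.modAll f hf).PiX)),
    let Env₀ : EnvOfGroup (EtaleLevels.setting C hC hS hlp hp2 hpl hζ τ.modAll f hf)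
        (EtaleLevels.modelSystem C hC hS hlp hp2 hpl hζ τ.modAll f hf τ.red_modAll h15 L hZ).PiX :=
      ThetaSetting.envOfGroup (C.rigidData (τ.modAll 1) hC hS h15 L)
        (ThetaSetting.SideData.ofDoubleUnderline C (τ.modAll 1) hC hS hlp hp2 hpl hζ (EtaleLevels.eta0_mem C hC hS τ.modAll f hf 1))
        (ThetaSetting.t1Space_Huu C) (ThetaSetting.isClosed_ker_aug_thetaEnvData C (τ.modAll 1) hC hS) (hZ 1)
        (EtaleThetaDataOfSetting.Pi C) hP
    ∀ (hcharY : EtaleThetaDataOfSetting.PiYddCharacteristic C),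
      Rmk141_pointedInversion' Env₀
        (etaleThetaDataOfSetting' C hC hS hcharY (EtaleLevels.setting C hC hS hlp hp2 hpl hζ τ.modAll f hf)
          (ContinuousMulEquiv.refl _) rfl) := by
  intro K₀ hC hS C f hf h15 L hO hYcl hp2 hpl hζ hZ hP Env₀ hcharY
  haveI : ((ThetaSetting.modelχq p 1 2 even_two).lDeltaTheta l).Normal := (ThetaSetting.modelχq p 1 2 even_two).lDeltaTheta_normal l
  haveI : IsMulCommutative ((ThetaSetting.modelχq p 1 2 even_two).lDeltaTheta l) :=
    EtaleThetaDataOfSetting.instIsMulCommutative_lDeltaTheta (D := ThetaSetting.modelχq p 1 2 even_two) l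
  -- the admissible involution `α := ι|Π^tp_{X̲̲}`
  let ι := inversionχq p 1 2
  have hιA : (ThetaSetting.modelχq p 1 2 even_two).IsInversionAut ι := isInversionAut_inversionχq p 1 2 even_two
  have hι : C.Huu.map ι.toMulEquiv.toMonoidHom = C.Huu := map_Huuχq_inversionχq p 1 2 l hl
  let α : (EtaleThetaDataOfSetting.Pi C) ≃ₜ* (EtaleThetaDataOfSetting.Pi C) := EtaleThetaDataOfSetting.inversionAlpha C ι hι
  have hover : ∀ x, Env₀.recon.projG (Env₀.isoX (α x)) = Env₀.recon.projG (Env₀.isoX x) := by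
    intro x
    rw [← inv_mul_eq_one, ← map_inv, ← map_mul, ← map_inv, ← map_mul]
    refine (EtaleThetaDataOfSetting.projG_isoX_envOfGroup_eq_one_iff_aug_modelTate p 1 2 even_two C (τ.modAll 1) hC hS
      h15 L hlp hp2 hpl hζ (EtaleLevels.eta0_mem C hC hS τ.modAll f hf 1) (hZ 1) hP ((α x)⁻¹ * x)).2 ?_
    show augχq p 1 2 ((ι (x : PiTpχq p 1 2))⁻¹ * (x : PiTpχq p 1 2)) = 1
    rw [map_mul, map_inv]
    change (ι (x : PiTpχq p 1 2)).right⁻¹ * (x : PiTpχq p 1 2).right = 1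
    rw [show (ι (x : PiTpχq p 1 2)).right = (x : PiTpχq p 1 2).right from rfl, inv_mul_cancel]
  have hδ : Env₀.recon.projG (Env₀.isoX 1) = 1 :=
    EtaleThetaDataOfSetting.projG_isoX_envOfGroup_one C (τ.modAll 1) hC hS h15 L hlp hp2 hpl hζ
      (EtaleLevels.eta0_mem C hC hS τ.modAll f hf 1) (hZ 1) hP
  have hαα : ∀ x : EtaleThetaDataOfSetting.Pi C, α (α x) = 1 * x * 1⁻¹ :=
    EtaleThetaDataOfSetting.inversionAlpha_inversionAlpha_of_sq C ι hι 1
      (EtaleThetaDataOfSetting.sq_conj_one_of_involutive C ι (inversionχq_inversionχq p 1 2))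
  let γ : EtaleThetaDataOfSetting.Pi C := (C.toLZ_surjective (Multiplicative.ofAdd 1)).choose
  have hγ : C.toLZ γ = Multiplicative.ofAdd 1 := (C.toLZ_surjective (Multiplicative.ofAdd 1)).choose_spec
  have hαγ : C.toLZ (α γ) = Multiplicative.ofAdd (-1) :=
    EtaleThetaDataOfSetting.toLZ_inversionAlpha_generator C ι hι γ hγ (hιA.toZ_apply γ)
  -- the point `D_{μ_-} := Π^tp_{X̲̲} ∩ inr(G_{ℚ_p})` and the root member of standard type (the `let`s of p477403)
  let Dμ : Subgroup (EtaleThetaDataOfSetting.Pi C) :=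
    ((SemidirectProduct.inr : GQp p →* PiTpχq p 1 2).range).subgroupOf C.Huu
  have hDmu : Dμ ≤ EtaleThetaDataOfSetting.PiYdd C := inrRange_subgroupOf_le_piYdd p 1 2 even_two C hS
  have hfixD := exists_fixD_inrRange_subgroupOf p C hι hcharY hS (fun x => Env₀.recon.projG (Env₀.isoX x) = 1) hδ
  let etaStd : (EtaleThetaDataOfSetting.coh C).H1 ⊤ :=
    (EtaleThetaDataOfSetting.h1Top C).symm (Additive.ofMul (EtaleThetaDataOfSetting.rootLiftClass C))
  have hmem : etaStd ∈ EtaleThetaDataOfSetting.orbitOne C hC :=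
    ⟨1, by haveI := EtaleThetaDataOfSetting.piYdd_normal C hC; rw [ContH1.conj_one_apply]⟩
  have hstd : (2 * (EtaleLevels.setting C hC hS hlp hp2 hpl hζ τ.modAll f hf).l) •
      EtaleThetaDataOfSetting.resDmuOf C Dμ hDmu etaStd = 0 :=
    hstd_rootMember_of_section p 1 2 even_two C rfl Dμ hDmu fun d hd => (mem_inrRange_subgroupOf_iff p 1 2 even_two C d).1 hd
  exact ⟨{ iota := α
           iota_over_G := hover
           iota_sq_inner := ⟨1, hδ, hαα⟩
           iota_not_inner := EtaleThetaDataOfSetting.not_inner_of_toLZ C α γ hγ hαγ _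
           iotaYdd := EtaleThetaDataOfSetting.iotaYddOfAut C hcharY α
           iotaYdd_lifts := ⟨1, by rw [map_one, map_one], fun y => by rw [inv_one, mul_one, one_mul]; rfl⟩
           Dmu := Dμ
           Dmu_le := hDmu
           iotaYdd_fixes := hfixD
           HDmu := Additive (ContH1 (EtaleThetaDataOfSetting.phi C)
             ((ThetaSetting.modelχq p 1 2 even_two).lDeltaTheta l) Dμ)
           resDmu := EtaleThetaDataOfSetting.resDmuOf C Dμ hDmu
           etaStd := etaStd
           etaStd_mem := hmem
           standard := hstd }⟩

/-- **The G11 pair at the model**: at `D_rec`, the PRIMED existence clause of Rmk. 1.4.1 (ii) holds while abc-iut-L6-t1's FROZEN one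
fails — `Rmk141_pointedInversion' Env₀ D_rec ∧ ¬ Rmk141_pointedInversion Env₀ D_rec` — i.e. «everything of Rmk. 1.4.1 (ii) except
(U1) holds at the model; (U1) fails there» (`rmk141'_modelTate` + `forall_not_isUniqueOuter_modelTate` through
`rmk141'_and_not_rmk141_of_forall_not_isUniqueOuter`). [claim: Mochizuki2012, status: disputed] (IUTchII §1 Rmk 1.4.1 (ii), kurims p.28) -/
theorem rmk141'_and_not_rmk141_modelTate :
    let hYcl := hYcl_modelχq p 1 2 even_two
    let hC := compat_modelχq p 1 2 even_two
    let hS := ThetaSetting.modelχq_sec2Hyps p 1 2 even_two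
    let K₀ := (kummerCoreχq p 1 2 even_two).toKummerDataOfSection SemidirectProduct.inr (continuous_inrχq p 1 2)
        (fun _ => rfl) (map_inr_GK_le_GtpY_modelχq' p 1 2 even_two) (map_inr_GKdd_le_GtpYdd_modelχq' p 1 2 even_two)
    let C := (K₀.etaleThetaDataOfClass (etaDdχq p 1 2 even_two)).doubleUnderlineχqOfEtaRes p 1 2 l hl
        (eta_res_etaDdχq p 1 2 even_two l hl)
    let f := EtaleThetaDataOfSetting.rootLift C
    let hf : f ∈ C.rootCocycles hC := rootLift_mem_rootCocycles C hC
    let h15 : Literature.AnabelianGeometry.EtaleTheta.ThetaSetting.Prop15iii _ hC :=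
      prop15iii_etaleThetaDataOfClass_etaDdχq p hC SemidirectProduct.inr
        (continuous_inrχq p 1 2) (fun _ => rfl) (map_inr_GK_le_GtpY_modelχq' p 1 2 even_two)
        (map_inr_GKdd_le_GtpYdd_modelχq' p 1 2 even_two)
    let L : C.CuspLabels := ⟨fun _ => ∅, fun _ => ∅, fun _ => rfl⟩
    let hO := ThetaSetting.modelχq_isEtThOrigin p 1 2 even_two
    let hp2 := ne_two_of_four_mul_dvd_pred p l.pos hdvd
    let hpl := ne_of_four_mul_dvd_pred p l.pos hdvd
    let hζ := exists_isPrimitiveRoot_K_modelχq p 1 2 even_two l.pos hdvd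
    let hZ : ∀ M : ℕ+, Nonempty (ModelCyclotomes.lDeltaQuot (C.rigidData (τ.modAll M) hC hS h15 L) ≃*
        Literature.IUT.HodgeTheaters.ZHat) := fun M =>
      ModelCyclotomes.nonempty_lDeltaQuot_rigidData_mulEquiv_zHat C (τ.modAll M) hC hS h15 L hO hYcl hlp.ne_zero
    ∀ (hP : Nonempty ((EtaleThetaDataOfSetting.Pi C) ≃ₜ* (EtaleLevels.setting C hC hS hlp hp2 hpl hζ τ.modAll f hf).PiX)),
    let Env₀ : EnvOfGroup (EtaleLevels.setting C hC hS hlp hp2 hpl hζ τ.modAll f hf)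
        (EtaleLevels.modelSystem C hC hS hlp hp2 hpl hζ τ.modAll f hf τ.red_modAll h15 L hZ).PiX :=
      ThetaSetting.envOfGroup (C.rigidData (τ.modAll 1) hC hS h15 L)
        (ThetaSetting.SideData.ofDoubleUnderline C (τ.modAll 1) hC hS hlp hp2 hpl hζ (EtaleLevels.eta0_mem C hC hS τ.modAll f hf 1))
        (ThetaSetting.t1Space_Huu C) (ThetaSetting.isClosed_ker_aug_thetaEnvData C (τ.modAll 1) hC hS) (hZ 1)
        (EtaleThetaDataOfSetting.Pi C) hP
    ∀ (hcharY : EtaleThetaDataOfSetting.PiYddCharacteristic C),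
      Rmk141_pointedInversion' Env₀
          (etaleThetaDataOfSetting' C hC hS hcharY
            (EtaleLevels.setting C hC hS hlp hp2 hpl hζ τ.modAll f hf) (ContinuousMulEquiv.refl _) rfl) ∧
        ¬ Rmk141_pointedInversion Env₀
          (etaleThetaDataOfSetting' C hC hS hcharY
            (EtaleLevels.setting C hC hS hlp hp2 hpl hζ τ.modAll f hf) (ContinuousMulEquiv.refl _) rfl) := by
  intro hYcl hC hS K₀ C f hf h15 L hO hp2 hpl hζ hZ hP Env₀ hcharY
  obtain ⟨I'⟩ := rmk141'_modelTate p l hl hlp hdvd τ hP hcharY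
  exact rmk141'_and_not_rmk141_of_forall_not_isUniqueOuter I'
    (forall_not_isUniqueOuter_modelTate p l hl hlp hdvd τ hP _)

/-! ### §3 (abc-iut-L6-d6). The (U1)-cut of the primed type is EMPTY at the model -/

/-- **`{I' : PointedInversion' Env₀ D // I'.IsUniqueOuter}` is EMPTY at the stage-2 Tate model**, for every identification `hP` and
every [EtTh]-side datum `D` — the subtype that abc-iut-L6-t1's `PointedInversion'.equivSubtype` identifies with the FROZEN
`PointedInversion Env₀ D` (EMPTY there: abc-iut-L6-d6 `isEmpty_pointedInversion_modelTate`, p496512); immediate from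
`forall_not_isUniqueOuter_modelTate`.  So at the model the primed type is inhabited (`rmk141'_modelTate`) while its (U1)-cut —
equivalently the frozen type — is empty: the G11 picture «repair inhabited, settled negative edge empty» in one line each.
[claim: Mochizuki2012, status: disputed] (IUTchII §1 Rmk 1.4.1 (ii), kurims p.28) -/
theorem isEmpty_subtype_isUniqueOuter_modelTate :
    let hζ := exists_isPrimitiveRoot_K_modelχq p 1 2 even_two l.pos hdvd
    let hC := compat_modelχq p 1 2 even_two
    let hS := ThetaSetting.modelχq_sec2Hyps p 1 2 even_two
    let K₀ := (kummerCoreχq p 1 2 even_two).toKummerDataOfSection SemidirectProduct.inr (continuous_inrχq p 1 2)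
        (fun _ => rfl) (map_inr_GK_le_GtpY_modelχq' p 1 2 even_two) (map_inr_GKdd_le_GtpYdd_modelχq' p 1 2 even_two)
    let C := (K₀.etaleThetaDataOfClass (etaDdχq p 1 2 even_two)).doubleUnderlineχqOfEtaRes p 1 2 l hl
        (eta_res_etaDdχq p 1 2 even_two l hl)
    let f := EtaleThetaDataOfSetting.rootLift C
    let hf : f ∈ C.rootCocycles hC := rootLift_mem_rootCocycles C hC
    let h15 : Literature.AnabelianGeometry.EtaleTheta.ThetaSetting.Prop15iii _ hC :=
      prop15iii_etaleThetaDataOfClass_etaDdχq p hC SemidirectProduct.inr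
        (continuous_inrχq p 1 2) (fun _ => rfl) (map_inr_GK_le_GtpY_modelχq' p 1 2 even_two)
        (map_inr_GKdd_le_GtpYdd_modelχq' p 1 2 even_two)
    let L : C.CuspLabels := ⟨fun _ => ∅, fun _ => ∅, fun _ => rfl⟩
    let hO := ThetaSetting.modelχq_isEtThOrigin p 1 2 even_two
    let hYcl := hYcl_modelχq p 1 2 even_two
    let hp2 := ne_two_of_four_mul_dvd_pred p l.pos hdvd
    let hpl := ne_of_four_mul_dvd_pred p l.pos hdvd
    let hZ : ∀ M : ℕ+, Nonempty (ModelCyclotomes.lDeltaQuot (C.rigidData (τ.modAll M) hC hS h15 L) ≃*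
        Literature.IUT.HodgeTheaters.ZHat) := fun M =>
      ModelCyclotomes.nonempty_lDeltaQuot_rigidData_mulEquiv_zHat C (τ.modAll M) hC hS h15 L hO hYcl hlp.ne_zero
    ∀ (hP : Nonempty ((EtaleThetaDataOfSetting.Pi C) ≃ₜ* (EtaleLevels.setting C hC hS hlp hp2 hpl hζ τ.modAll f hf).PiX)),
    let Env₀ : EnvOfGroup (EtaleLevels.setting C hC hS hlp hp2 hpl hζ τ.modAll f hf)
        (EtaleLevels.modelSystem C hC hS hlp hp2 hpl hζ τ.modAll f hf τ.red_modAll h15 L hZ).PiX :=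
      ThetaSetting.envOfGroup (C.rigidData (τ.modAll 1) hC hS h15 L)
        (ThetaSetting.SideData.ofDoubleUnderline C (τ.modAll 1) hC hS hlp hp2 hpl hζ (EtaleLevels.eta0_mem C hC hS τ.modAll f hf 1))
        (ThetaSetting.t1Space_Huu C) (ThetaSetting.isClosed_ker_aug_thetaEnvData C (τ.modAll 1) hC hS) (hZ 1)
        (EtaleThetaDataOfSetting.Pi C) hP
    ∀ D : EtaleThetaData (EtaleLevels.setting C hC hS hlp hp2 hpl hζ τ.modAll f hf)
        (EtaleLevels.modelSystem C hC hS hlp hp2 hpl hζ τ.modAll f hf τ.red_modAll h15 L hZ).PiX,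
      IsEmpty {I' : PointedInversion' Env₀ D // I'.IsUniqueOuter} := by
  intro hζ hC hS K₀ C f hf h15 L hO hYcl hp2 hpl hZ hP Env₀ D
  exact ⟨fun I' => forall_not_isUniqueOuter_modelTate p l hl hlp hdvd τ hP D I'.1 I'.2⟩

end ModelTateCarriers

end Literature.IUT.HodgeArakelov

end
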